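import Summits.QuantumAdvantage.QuantumAdvantage.Theorems.LinnikCubicClassGroupsDegreeOnePrimesEscapeClassPNTAdditive
import Literature.NumberTheory.QuadraticFields.RealQuadraticRegulatorLowerBound
import HarnessLib

/-!
# The additive class prime number theorem, IX: every number field of degree `2` or `3`, unconditionally

Topic `Summits/QuantumAdvantage/QuantumAdvantage/Theorems`, cell B2b-1 (linnik-cubic), PART A, the
`stub_classPNTAdditive` slice of the crux `DegreeOnePrimesEscape` (stmt-QuantumAdvantage-11543) of route
`LinnikCubicClassGroups`, in DEGREE-LOCAL form.  HONEST FRAMING: the value of this file is a THEOREM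
(kernel-checked) — NOT summit progress.

The residue hypothesis `κ_K ≥ Q^{−A}` of `classPNTAdditive_of_kappa_local` is discharged by the tree for EVERY
quadratic field (`Quadratic.condQn_rpow_neg_one_le_residue_of_finrank_eq_two`: class number formula, `h_K ≥ 1`,
`R_K ≥ log((1+√5)/2)` in the real case) and for every cubic field (`classPNTAdditive_three`, Stark).  Hence:

* `classPNTAdditive_quadratic` — the additive class prime number theorem dichotomy for ALL quadratic fields
  (real and imaginary), GRH-free and Siegel-free (the possible exceptional zero is kept explicit);
* `classPNTAdditive_of_le_three (n) (1 < n ≤ 3)` — the dichotomy, with one constant per degree, for every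
  number field of degree `2` or `3`: the shape of the registered stub `ClassPNTAdditive` restricted to
  `[K:ℚ] ≤ 3` (the stub itself asks for one absolute constant over all degrees).
-/

noncomputable section

open Complex Real MeasureTheory Set Filter Topology
open scoped NumberField nonZeroDivisors

namespace Summit.QuantumAdvantage.QuantumAdvantage.Theorems.DegreeOnePrimesEscape

open Literature.NumberTheory.LFunctions Literature.NumberTheory.LFunctions.NumberField
  Literature.NumberTheory.LFunctions.AbelianDensity Literature.NumberTheory.QuadraticFields

/-- **The additive class prime number theorem dichotomy for QUADRATIC fields (real or imaginary),
unconditional**: there is `c₁ > 0` such that for every number field `K` of degree `2` (`Q = 4|d_K|`,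
`h = h_K`), EITHER `|π_C(x) − Li(x)/h| ≤ Li(x)/(32h)` for every class `C` and every `x ≥ Q^{c₁}`, OR there
are a real class group character `χ₁` and a real zero `β₁ ∈ (1 − 1/(8 log Q), 1)` of `L(s, χ₁)` with
`|π_C(x) − (Li(x) − Re χ₁(C) Li(x^{β₁}))/h| ≤ Li(x)/(32h)` for every `C`, every `x ≥ Q^{c₁}`. -/
theorem classPNTAdditive_quadratic :
    ∃ c₁ : ℝ, 0 < c₁ ∧ ∀ (K : Type) [Field K] [NumberField K], Module.finrank ℚ K = 2 →
      ((∀ (C : ClassGroup (𝓞 K)) (x : ℝ), ThornerZaman.condQn K ^ c₁ ≤ x →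
          |(primeIdealClassCount K C x : ℝ) - offsetLogIntegral x / NumberField.classNumber K| ≤
            offsetLogIntegral x / (32 * NumberField.classNumber K)) ∨
        ∃ (χ₁ : ClassGroup (𝓞 K) →* ℂˣ) (β₁ : ℝ), χ₁ * χ₁ = 1 ∧
          1 - 1 / (8 * Real.log (ThornerZaman.condQn K)) < β₁ ∧ β₁ < 1 ∧
          classGroupLFunction K χ₁ β₁ = 0 ∧
          ∀ (C : ClassGroup (𝓞 K)) (x : ℝ), ThornerZaman.condQn K ^ c₁ ≤ x →
            |(primeIdealClassCount K C x : ℝ) -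
                (offsetLogIntegral x - ((χ₁ C : ℂ)).re * offsetLogIntegral (x ^ β₁)) /
                  NumberField.classNumber K| ≤
              offsetLogIntegral x / (32 * NumberField.classNumber K)) := by
  obtain ⟨c₁, hc₁, h⟩ := classPNTAdditive_of_kappa_local 2 (by norm_num) 1
  exact ⟨c₁, hc₁, fun K _ _ hK ↦
    h K hK (Quadratic.condQn_rpow_neg_one_le_residue_of_finrank_eq_two (K := K) hK)⟩

/-- **The additive class prime number theorem dichotomy for every number field of degree `2` or `3`,
unconditional** — the registered stub `ClassPNTAdditive` restricted to `1 < [K:ℚ] ≤ 3`, with one constant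
per degree: for `1 < n ≤ 3` there is `c₁ > 0` such that every number field of degree `n` satisfies the
dichotomy of `classPNTAdditive_of_kappa_local` with no residue hypothesis. -/
theorem classPNTAdditive_of_le_three (n : ℕ) (hn : 1 < n) (hn3 : n ≤ 3) :
    ∃ c₁ : ℝ, 0 < c₁ ∧ ∀ (K : Type) [Field K] [NumberField K], Module.finrank ℚ K = n →
      ((∀ (C : ClassGroup (𝓞 K)) (x : ℝ), ThornerZaman.condQn K ^ c₁ ≤ x →
          |(primeIdealClassCount K C x : ℝ) - offsetLogIntegral x / NumberField.classNumber K| ≤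
            offsetLogIntegral x / (32 * NumberField.classNumber K)) ∨
        ∃ (χ₁ : ClassGroup (𝓞 K) →* ℂˣ) (β₁ : ℝ), χ₁ * χ₁ = 1 ∧
          1 - 1 / (8 * Real.log (ThornerZaman.condQn K)) < β₁ ∧ β₁ < 1 ∧
          classGroupLFunction K χ₁ β₁ = 0 ∧
          ∀ (C : ClassGroup (𝓞 K)) (x : ℝ), ThornerZaman.condQn K ^ c₁ ≤ x →
            |(primeIdealClassCount K C x : ℝ) -
                (offsetLogIntegral x - ((χ₁ C : ℂ)).re * offsetLogIntegral (x ^ β₁)) /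
                  NumberField.classNumber K| ≤
              offsetLogIntegral x / (32 * NumberField.classNumber K)) := by
  interval_cases n
  · exact classPNTAdditive_quadratic
  · exact classPNTAdditive_three

end Summit.QuantumAdvantage.QuantumAdvantage.Theorems.DegreeOnePrimesEscape

end
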